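import Summits.QuantumFields.YangMills.Theorems.NPointIsotropy.Negative.TieLoadBearing
import Summits.QuantumFields.YangMills.Theorems.NPointIsotropy.Negative.DegreeTwoFree
import Summits.QuantumFields.YangMills.Theorems.NPointIsotropy.Negative.NPointRegularJunk
import Summits.QuantumFields.YangMills.Theorems.CurvatureBoostCovariance.Negative.Unbundled
import Summits.QuantumFields.YangMills.Theorems.MirrorModularBoostsPlanarSpectralCone
import Summits.QuantumFields.YangMills.Theorems.MirrorModularBoostsCurvatureBoostCovarianceTensorDensity
import Summits.QuantumFields.YangMills.Theorems.MirrorModularBoostsCurvatureBoostCovarianceDoubledToInvariant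
import Summits.QuantumFields.YangMills.Theorems.MirrorModularBoostsCurvatureBoostCovarianceRayPositivity
import Summits.QuantumFields.YangMills.Theorems.MirrorModularBoostsCurvatureBoostCovarianceOrbitBandlimit
import Summits.QuantumFields.YangMills.Theorems.MirrorModularBoostsCurvatureBoostCovarianceLevelGrowthLow
import Summits.QuantumFields.YangMills.Theorems.MirrorModularBoostsCurvatureBoostCovarianceParitySieve
import Summits.QuantumFields.YangMills.Theorems.MirrorModularBoostsCurvatureBoostCovarianceGramVecOnStrip
import Literature.MathematicalPhysics.QuantumFieldTheory.OSReconstructionNoE1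
import Literature.MathematicalPhysics.QuantumFieldTheory.SchwingerLimitInheritance
import HarnessLib

/-!
# `NPointIsotropy` — the CORE CERTIFICATE: the crux follows from three named statements (line `complex-rotation-bandlimit`, gen 7)

Support file for crux `stmt-QuantumFields-11686` (`PencilRigidity.NPointIsotropy`), lead `prover-line-stmt-QuantumFields-11686-c2-0`:
a sorry-free proof that the crux is implied by the conjunction of THREE statements, each stated verbatim as registered on this crux
AND on the sibling crux `stmt-QuantumFields-9663` (`MirrorModularBoosts.CurvatureBoostCovariance`, skeleton
`Cruxes/CurvatureBoostCovariance/Lines/boosts_inherit_mirrors.lean`), so that one proof of each serves both cruxes (and 14999):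
**Step 0** (`W1 + EightFrameRP + PlanarCone ⇒ NPointRegular`, uses the lattice tie, excludes the junk family), **the doubled orbit
kernel** (the analytic input in scalar form: OS II multi-slot continuation WITHOUT E1 along complex-rotation orbits of doubled
configurations; model-blind), **level growth at levels `a ≥ 2`** (the Yang–Mills bet: given planar invariance in degrees `≤ 2a − 2`,
the diagonal doubled pencil of a degree-`a` test function has no layer `|k| ≥ 2`).  Everything else is LANDED and imported: the
cone theorem of item 9664, the sibling's levers `stub_orbitBandlimit`, `stub_rayPositivity`, `stub_paritySieve`,
`stub_doubledToInvariant`, `stub_tensorDensity`, `stub_gramVecOnStrip`, and — the one place where THIS crux is easier than 9663 —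
the level growth at levels `a ≤ 1`, FREE here from the crux's radial two-point kernel (`levelGrowthLow_of_radialKernel`), where
9663 pays `CurvatureKernelBound` + `ShellRigidity` + `KernelTransfer`.

* `levelGrowthLow_of_radialKernel`, `levelGrowthLow_shape` — levels `a ≤ 1` from `RadialKernel`;
* `uniformPlanarBoostVectors_of_kernel` — doubled orbit kernel + `stub_gramVecOnStrip` ⇒ uniform planar boost vectors;
* `planarInvariant_of_inputs` — the model-blind sieve (the sibling's `sieve_of_stubs`, inputs as hypotheses);
* `nPointIsotropy_of_inputs` — THE CERTIFICATE: Step 0 → doubled orbit kernel → level growth (`a ≥ 2`) → `NPointIsotropy`.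
[folklore]
-/

noncomputable section

namespace Summit.QuantumFields.YangMills.Theorems.NPointIsotropy.ComplexRotationBandlimit

open scoped BigOperators SchwartzMap InnerProductSpace
open MeasureTheory Filter Topology
open Literature.MathematicalPhysics.QuantumLattice Literature.MathematicalPhysics.AQFT
  Literature.MathematicalPhysics.QuantumFieldTheory
open Summit.QuantumFields.YangMills.Theorems.NPointIsotropy.Negative (E4 RadialKernel NPointRegular nPointIsotropy_iff
  radialKernel_invariant_two)
open Summit.QuantumFields.YangMills.Theorems.CurvatureBoostCovariance.Negative
  (OSPackage Translations Hypercubic EightFrameRP PlanarCone PlanarInvariant Tie Gaps W1)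
open Summit.QuantumFields.YangMills.Theorems.CurvatureBoostCovariance.BoostsInheritMirrors
  (stub_orbitBandlimit stub_rayPositivity stub_paritySieve stub_doubledToInvariant stub_tensorDensity stub_gramVecOnStrip
    trigPoly_coeff_eq_zero_of_const)

/-! ## Levels `a ≤ 1` are free under the radial kernel -/

/-- **Level growth at levels `a ≤ 1` from the RADIAL KERNEL alone**: for an `e₀`-time-ordered one-point `F`, any witness `H`
of `ΘF* ⊗ F` is off-diagonal (`IsAppendTensorOf.isOffDiagonal_of_isTimeOrdered`), so `radialKernel_invariant_two` makes its
orbit function CONSTANT and the non-zero layers of any trigonometric representation vanish (`trigPoly_coeff_eq_zero_of_const`);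
level `a = 0` is trivial (`linActMulti` is the identity in degree `0`). [folklore] -/
theorem levelGrowthLow_of_radialKernel : ∀ (S₁ : Literature.MathematicalPhysics.QuantumLattice.SchwingerFamily (EuclideanSpace ℝ (Fin 4))), Summit.QuantumFields.YangMills.Theorems.NPointIsotropy.Negative.RadialKernel S₁ → ∀ a : ℕ, a ≤ 1 → ∀ (F : SchwartzMap (Fin a → EuclideanSpace ℝ (Fin 4)) ℂ), Literature.MathematicalPhysics.QuantumLattice.IsTimeOrdered F → ∀ H : SchwartzMap (Fin (a + a) → EuclideanSpace ℝ (Fin 4)) ℂ, Literature.MathematicalPhysics.QuantumLattice.IsAppendTensorOf H (Literature.MathematicalPhysics.QuantumLattice.osAdjoint F) F → ∀ (K : ℕ) (p : ℤ → ℂ), (∀ θ : ℝ, S₁ (a + a) (Literature.MathematicalPhysics.QuantumLattice.linActMulti (Literature.MathematicalPhysics.QuantumFieldTheory.planeRot (0 : Fin 3) θ) H) = ∑ k ∈ Finset.Icc (-(K : ℤ)) K, p k * Complex.exp (4 * (k : ℂ) * (θ : ℂ) * Complex.I)) → ∀ k ∈ Finset.Icc (-(K : ℤ)) K, k ≠ 0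 → p k = 0 := by
  intro S₁ hK a ha F hF H hH K p hp
  have hconst : ∀ θ : ℝ, S₁ (a + a) (linActMulti (planeRot (0 : Fin 3) θ) H) = S₁ (a + a) H := by
    obtain rfl | rfl : a = 0 ∨ a = 1 := by omega
    · intro θ
      congr 1
      ext x
      rw [linActMulti_apply]
      congr 1
      funext i
      exact Fin.elim0 i
    · have hHoff : IsOffDiagonal H := hH.isOffDiagonal_of_isTimeOrdered hF hF
      intro θ
      exact radialKernel_invariant_two hK (planeRot (0 : Fin 3) θ) H hHoff
  intro k hk hk0
  exact trigPoly_coeff_eq_zero_of_const K p (S₁ (a + a) H) (fun θ => (hp θ).symm.trans (hconst θ)) k hk hk0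

/-- The level-growth SHAPE at levels `a ≤ 1` (induction hypothesis carried and unused), from the radial kernel. [folklore] -/
theorem levelGrowthLow_shape {S₁ : SchwingerFamily E4} (hK : RadialKernel S₁) :
    ∀ a : ℕ, a ≤ 1 →
      (∀ N : ℕ, N + 2 ≤ 2 * a → ∀ R : E4 ≃ₗᵢ[ℝ] E4,
        LinearMap.det (R.toLinearEquiv : E4 →ₗ[ℝ] E4) = 1 →
        R (EuclideanSpace.single 2 1) = EuclideanSpace.single 2 1 →
        R (EuclideanSpace.single 3 1) = EuclideanSpace.single 3 1 →
        ∀ F : 𝓢((Fin N → E4), ℂ), IsOffDiagonal F → S₁ N (linActMulti R F) = S₁ N F) →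
      ∀ (F : 𝓢((Fin a → E4), ℂ)), IsTimeOrdered F → HasCompactSupport (F : (Fin a → E4) → ℂ) →
      ∀ H : 𝓢((Fin (a + a) → E4), ℂ), IsAppendTensorOf H (osAdjoint F) F →
      ∀ (K : ℕ) (p : ℤ → ℂ),
        (∀ θ : ℝ, S₁ (a + a) (linActMulti (planeRot (0 : Fin 3) θ) H) =
          ∑ k ∈ Finset.Icc (-(K : ℤ)) K, p k * Complex.exp (4 * (k : ℂ) * (θ : ℂ) * Complex.I)) →
        ∀ k ∈ Finset.Icc (-(K : ℤ)) K, 2 ≤ |k| → p k = 0 := by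
  intro a ha _ F hF _ H hH K p hp k hk hk2
  refine levelGrowthLow_of_radialKernel S₁ hK a ha F hF H hH K p hp k hk ?_
  rintro rfl
  rw [abs_zero] at hk2
  exact absurd hk2 (by norm_num)

/-! ## The analytic input packaged: doubled orbit kernel ⇒ uniform planar boost vectors (the sibling's Stub 4a, verbatim proof) -/

/-- **Uniform planar boost vectors from the doubled orbit kernel** (the sibling's `stub_uniformPlanarBoostVectors`, the kernel
statement as hypothesis `hDOK`; operator cone from the landed 9664 parts, packaging by `stub_gramVecOnStrip`). [folklore] -/
theorem uniformPlanarBoostVectors_of_kernel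
    (hDOK :
      open Literature.MathematicalPhysics.QuantumLattice Literature.MathematicalPhysics.AQFT
        Literature.MathematicalPhysics.QuantumFieldTheory
        Summit.QuantumFields.YangMills.Theorems.CurvatureBoostCovariance.Negative
        Summit.QuantumFields.YangMills.Theorems.NPointIsotropy.Negative in
      ∀ (S₁ : SchwingerFamily E4) (h : OSReconstructionNoE1 S₁.toLabelled),
        S₁.toLabelled.HasLinearGrowth → S₁.toLabelled.IsSymmetric → EightFrameRP S₁ → PlanarCone S₁ →
        (∀ (ψ : h.Hilbert) (μ : MeasureTheory.Measure E4), h.IsJointSpectralMeasure ψ μ →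
          μ {p : E4 | p 0 < |p 1|} = 0) →
        ∀ (n : ℕ), ∃ N : ℝ, ∀ (F : SchwartzMap (Fin n → E4) ℂ), IsTimeOrdered F →
          HasCompactSupport (F : (Fin n → E4) → ℂ) →
          ∃ ε : ℝ, 0 < ε ∧
            (∀ η : ℝ, |η| < ε → IsTimeOrdered (linActMulti (planeRot (0 : Fin 3) η) F)) ∧
            ∃ (K : ℂ → ℂ → ℂ) (C : ℝ),
              DifferentiableOn ℂ (Function.uncurry K) ({z : ℂ | |z.re| < ε} ×ˢ {z : ℂ | |z.re| < ε}) ∧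
              (∀ θ : ℂ, |θ.re| < ε → ‖K (starRingEnd ℂ θ) θ‖ ≤ C * Real.exp (2 * N * |θ.im|)) ∧
              ∀ η η' : ℝ, |η| < ε → |η'| < ε →
                ∀ H : SchwartzMap (Fin (n + n) → E4) ℂ,
                  IsAppendTensorOf H (osAdjoint (linActMulti (planeRot (0 : Fin 3) η') F))
                    (linActMulti (planeRot (0 : Fin 3) η) F) →
                  K η' η = S₁ (n + n) H) :
    open Literature.MathematicalPhysics.QuantumLattice Literature.MathematicalPhysics.AQFT
      Literature.MathematicalPhysics.QuantumFieldTheory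
      Summit.QuantumFields.YangMills.Theorems.CurvatureBoostCovariance.Negative
      Summit.QuantumFields.YangMills.Theorems.NPointIsotropy.Negative in
    ∀ (S₁ : SchwingerFamily E4) (h : OSReconstructionNoE1 S₁.toLabelled),
      S₁.toLabelled.HasLinearGrowth → S₁.toLabelled.IsSymmetric → EightFrameRP S₁ → PlanarCone S₁ →
      ∀ (n : ℕ), ∃ N : ℝ, ∀ (F : SchwartzMap (Fin n → E4) ℂ), IsTimeOrdered F →
        HasCompactSupport (F : (Fin n → E4) → ℂ) →
        ∃ ε : ℝ, 0 < ε ∧ ∃ (V : ℂ → h.Hilbert) (C : ℝ),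
          DifferentiableOn ℂ V {θ : ℂ | |θ.re| < ε} ∧
          (∀ θ : ℂ, |θ.re| < ε → ‖V θ‖ ≤ C * Real.exp (N * |θ.im|)) ∧
          ∀ θ : ℝ, |θ| < ε → ∀ hθ : IsTimeOrdered (linActMulti (planeRot (0 : Fin 3) θ) F),
            V θ = h.fieldVec n (fun _ => ()) (linActMulti (planeRot (0 : Fin 3) θ) F) hθ := by
  classical
  intro S₁ h hlg hsym h8 hC n
  have htr : Translations S₁ := fun N a F hF => h.translationInvariant N (fun _ => ()) a F hF
  have hop : ∀ (ψ : h.Hilbert) (μ : MeasureTheory.Measure E4), h.IsJointSpectralMeasure ψ μ →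
      μ {p : E4 | p 0 < |p 1|} = 0 :=
    Summit.QuantumFields.YangMills.Cruxes.PlanarSpectralCone.PositivityDiscToOperatorCone.planarConeSupport_of_parts
      Summit.QuantumFields.YangMills.Cruxes.PlanarSpectralCone.PositivityDiscToOperatorCone.stub_discSections
      Summit.QuantumFields.YangMills.Cruxes.PlanarSpectralCone.PositivityDiscToOperatorCone.stub_cone_of_discSections
      Summit.QuantumFields.YangMills.Cruxes.PlanarSpectralCone.PositivityDiscToOperatorCone.stub_density
      Summit.QuantumFields.YangMills.Cruxes.PlanarSpectralCone.PositivityDiscToOperatorCone.stub_linearity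
      S₁ hlg hsym htr h8 h
  obtain ⟨N, hN⟩ := hDOK S₁ h hlg hsym h8 hC hop n
  refine ⟨N, fun F hF hFc => ?_⟩
  obtain ⟨ε, hε, hto, K, C, hKd, hKg, hKr⟩ := hN F hF hFc
  -- the field vectors of the rotated test functions at the real points of the strip
  let Φ : ℝ → h.Hilbert := fun η =>
    if hη : |η| < ε then h.fieldVec n (fun _ => ()) (linActMulti (planeRot (0 : Fin 3) η) F) (hto η hη) else 0
  have hGram : ∀ η η' : ℝ, |η| < ε → |η'| < ε → ⟪Φ η', Φ η⟫_ℂ = K η' η := by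
    intro η η' hη hη'
    simp only [Φ, dif_pos hη, dif_pos hη']
    obtain ⟨H, hH⟩ := exists_isAppendTensorOf (osAdjoint (linActMulti (planeRot (0 : Fin 3) η') F))
      (linActMulti (planeRot (0 : Fin 3) η) F)
    rw [h.inner_fieldVec_fieldVec _ _ (hto η' hη') (hto η hη) hH, hKr η η' hη hη' H hH]
    rfl
  obtain ⟨Ψ, hΨd, hΨr, hΨg⟩ := stub_gramVecOnStrip h.Hilbert ε hε Φ K hKd hGram
  refine ⟨ε, hε, Ψ, Real.sqrt C, hΨd, fun θ hθ => ?_, fun θ hθ hθ' => ?_⟩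
  · have hsq : ‖Ψ θ‖ ^ 2 ≤ C * Real.exp (2 * N * |θ.im|) := by
      have h1 : (‖Ψ θ‖ ^ 2 : ℝ) = (⟪Ψ θ, Ψ θ⟫_ℂ).re := by
        rw [← inner_self_eq_norm_sq (𝕜 := ℂ) (Ψ θ)]; rfl
      rw [h1, hΨg θ θ hθ hθ]
      exact (Complex.re_le_norm _).trans (hKg θ hθ)
    have hC : 0 ≤ C := by
      by_contra hC
      have : C * Real.exp (2 * N * |θ.im|) < 0 := mul_neg_of_neg_of_pos (lt_of_not_ge hC) (Real.exp_pos _)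
      exact absurd (hsq.trans_lt this) (not_lt.2 (sq_nonneg _))
    have hrhs : C * Real.exp (2 * N * |θ.im|) = (Real.sqrt C * Real.exp (N * |θ.im|)) ^ 2 := by
      rw [mul_pow, Real.sq_sqrt hC, sq (Real.exp _), ← Real.exp_add]
      congr 1; ring_nf
    rw [hrhs] at hsq
    exact (pow_le_pow_iff_left₀ (norm_nonneg _) (by positivity) two_ne_zero).1 hsq
  · simp only [hΨr θ hθ, Φ, dif_pos hθ]

/-! ## The sibling's model-blind sieve, inputs as hypotheses (verbatim logic) -/

/-- **Uniform planar boost vectors imply the non-uniform form** (the first hypothesis of `stub_rayPositivity`; pure logic). [folklore] -/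
theorem planarBoostVectors_of_uniform
    (h₁ : ∀ (S₁ : SchwingerFamily E4) (h : OSReconstructionNoE1 S₁.toLabelled),
            S₁.toLabelled.HasLinearGrowth → S₁.toLabelled.IsSymmetric → EightFrameRP S₁ → PlanarCone S₁ →
            ∀ (n : ℕ), ∃ N : ℝ, ∀ (F : SchwartzMap (Fin n → E4) ℂ), IsTimeOrdered F →
              HasCompactSupport (F : (Fin n → E4) → ℂ) →
              ∃ ε : ℝ, 0 < ε ∧ ∃ (V : ℂ → h.Hilbert) (C : ℝ),
                DifferentiableOn ℂ V {θ : ℂ | |θ.re| < ε} ∧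
                (∀ θ : ℂ, |θ.re| < ε → ‖V θ‖ ≤ C * Real.exp (N * |θ.im|)) ∧
                ∀ θ : ℝ, |θ| < ε → ∀ hθ : IsTimeOrdered (linActMulti (planeRot (0 : Fin 3) θ) F),
                  V θ = h.fieldVec n (fun _ => ()) (linActMulti (planeRot (0 : Fin 3) θ) F) hθ) :
    open Literature.MathematicalPhysics.QuantumLattice Literature.MathematicalPhysics.AQFT
      Literature.MathematicalPhysics.QuantumFieldTheory
      Summit.QuantumFields.YangMills.Theorems.CurvatureBoostCovariance.Negative
      Summit.QuantumFields.YangMills.Theorems.NPointIsotropy.Negative in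
    ∀ (S₁ : SchwingerFamily E4) (h : OSReconstructionNoE1 S₁.toLabelled),
      S₁.toLabelled.HasLinearGrowth → S₁.toLabelled.IsSymmetric → EightFrameRP S₁ → PlanarCone S₁ →
      ∀ (n : ℕ) (F : SchwartzMap (Fin n → E4) ℂ), IsTimeOrdered F →
        HasCompactSupport (F : (Fin n → E4) → ℂ) →
        ∃ ε : ℝ, 0 < ε ∧ ∃ (V : ℂ → h.Hilbert) (C N : ℝ),
          DifferentiableOn ℂ V {θ : ℂ | |θ.re| < ε} ∧
          (∀ θ : ℂ, |θ.re| < ε → ‖V θ‖ ≤ C * Real.exp (N * |θ.im|)) ∧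
          ∀ θ : ℝ, |θ| < ε → ∀ hθ : IsTimeOrdered (linActMulti (planeRot (0 : Fin 3) θ) F),
            V θ = h.fieldVec n (fun _ => ()) (linActMulti (planeRot (0 : Fin 3) θ) F) hθ := by
  intro S₁ h hlg hsym h8 hC n F hF hFc
  obtain ⟨N, hN⟩ := h₁ S₁ h hlg hsym h8 hC n
  obtain ⟨ε, hε, V, C, hd, hg, hv⟩ := hN F hF hFc
  exact ⟨ε, hε, V, C, N, hd, hg, hv⟩

/-- The rotation by the angle `0` acts trivially on test functions. [folklore] -/
theorem linActMulti_planeRot_angle_zero {n : ℕ} (H : 𝓢((Fin n → E4), ℂ)) :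
    linActMulti (planeRot (0 : Fin 3) 0) H = H := by
  ext x
  rw [linActMulti_apply]
  congr 1
  funext i
  exact (planeRot (0 : Fin 3) 0).injective (by rw [LinearIsometryEquiv.apply_symm_apply, planeRot_zero_apply])

/-- **The model-blind sieve** (the sibling's `sieve_of_stubs`, verbatim: landed levers `stub_orbitBandlimit`, `stub_rayPositivity`,
`stub_doubledToInvariant`, `stub_tensorDensity`, `stub_paritySieve` and the landed cone theorem of 9664, with the uniform planar
boost vectors `h4a`, the Step-0 residual and the level growth as HYPOTHESES): for a one-species family with the OS package, translations, proper hypercubic invariance, E2 in the eight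
planar frames and the planar cone, IF every `𝔖ₙ|⁰𝒮` is a function and the level growth holds at every level, then
`S₁` is planar-invariant on `⁰𝒮`.  The lattice enters the crux only through the two hypotheses `hreg` (stub 1) and
`hgrow` (stub 5).  Proof: by induction on the level `a`, every doubled orbit function with `deg F, deg G ≤ a` is
constant — the induction hypothesis and stub 6 give invariance in degrees `≤ 2a - 2`, stub 5 kills the layers
`|k| ≥ 2` of the two diagonal blocks, stub 4 gives positivity of the 2×2 pencil on `ℝ∖0`, `Sieve.paritySieve` makes
the `(F,G)` block constant; then stub 6 at level `N` gives degree `N`. [folklore] -/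
theorem planarInvariant_of_inputs
    (h4a :
        ∀ (S₁ : SchwingerFamily E4) (h : OSReconstructionNoE1 S₁.toLabelled),
          S₁.toLabelled.HasLinearGrowth → S₁.toLabelled.IsSymmetric → EightFrameRP S₁ → PlanarCone S₁ →
          ∀ (n : ℕ), ∃ N : ℝ, ∀ (F : SchwartzMap (Fin n → E4) ℂ), IsTimeOrdered F →
            HasCompactSupport (F : (Fin n → E4) → ℂ) →
            ∃ ε : ℝ, 0 < ε ∧ ∃ (V : ℂ → h.Hilbert) (C : ℝ),
              DifferentiableOn ℂ V {θ : ℂ | |θ.re| < ε} ∧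
              (∀ θ : ℂ, |θ.re| < ε → ‖V θ‖ ≤ C * Real.exp (N * |θ.im|)) ∧
              ∀ θ : ℝ, |θ| < ε → ∀ hθ : IsTimeOrdered (linActMulti (planeRot (0 : Fin 3) θ) F),
                V θ = h.fieldVec n (fun _ => ()) (linActMulti (planeRot (0 : Fin 3) θ) F) hθ )
    (S₁ : SchwingerFamily E4) (hOS : OSPackage S₁) (htr : Translations S₁)
    (hhyp : Hypercubic S₁) (h8 : EightFrameRP S₁) (hC : PlanarCone S₁)
    (hreg : NPointRegular S₁)
    (hgrow : ∀ a : ℕ,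
      (∀ N : ℕ, N + 2 ≤ 2 * a → ∀ R : E4 ≃ₗᵢ[ℝ] E4,
        LinearMap.det (R.toLinearEquiv : E4 →ₗ[ℝ] E4) = 1 →
        R (EuclideanSpace.single 2 1) = EuclideanSpace.single 2 1 →
        R (EuclideanSpace.single 3 1) = EuclideanSpace.single 3 1 →
        ∀ F : 𝓢((Fin N → E4), ℂ), IsOffDiagonal F → S₁ N (linActMulti R F) = S₁ N F) →
      ∀ (F : 𝓢((Fin a → E4), ℂ)), IsTimeOrdered F → HasCompactSupport (F : (Fin a → E4) → ℂ) →
      ∀ H : 𝓢((Fin (a + a) → E4), ℂ), IsAppendTensorOf H (osAdjoint F) F →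
      ∀ (K : ℕ) (p : ℤ → ℂ),
        (∀ θ : ℝ, S₁ (a + a) (linActMulti (planeRot (0 : Fin 3) θ) H) =
          ∑ k ∈ Finset.Icc (-(K : ℤ)) K, p k * Complex.exp (4 * (k : ℂ) * (θ : ℂ) * Complex.I)) →
        ∀ k ∈ Finset.Icc (-(K : ℤ)) K, 2 ≤ |k| → p k = 0) :
    PlanarInvariant S₁ := by
  have hband := stub_orbitBandlimit h4a S₁ hOS htr hhyp h8 hC hreg
  have hpos := stub_rayPositivity (planarBoostVectors_of_uniform h4a) S₁ hOS htr h8 hC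
    Summit.QuantumFields.YangMills.Cruxes.PlanarSpectralCone.PositivityDiscToOperatorCone.PlanarSpectralCone_of
  have hd2i := stub_doubledToInvariant stub_tensorDensity S₁ hOS htr hreg
  -- one level of the induction: invariance below `2a - 1` ⇒ doubled-orbit constancy up to level `a`
  have level_step : ∀ a : ℕ,
      (∀ N : ℕ, N + 2 ≤ 2 * a → ∀ R : E4 ≃ₗᵢ[ℝ] E4,
        LinearMap.det (R.toLinearEquiv : E4 →ₗ[ℝ] E4) = 1 →
        R (EuclideanSpace.single 2 1) = EuclideanSpace.single 2 1 →
        R (EuclideanSpace.single 3 1) = EuclideanSpace.single 3 1 →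
        ∀ F : 𝓢((Fin N → E4), ℂ), IsOffDiagonal F → S₁ N (linActMulti R F) = S₁ N F) →
      ∀ n m : ℕ, n ≤ a → m ≤ a →
        ∀ (F : 𝓢((Fin n → E4), ℂ)) (G : 𝓢((Fin m → E4), ℂ)),
          IsTimeOrdered F → IsTimeOrdered G →
          HasCompactSupport (F : (Fin n → E4) → ℂ) → HasCompactSupport (G : (Fin m → E4) → ℂ) →
          ∀ H : 𝓢((Fin (n + m) → E4), ℂ), IsAppendTensorOf H (osAdjoint F) G →
            ∀ θ : ℝ, S₁ (n + m) (linActMulti (planeRot (0 : Fin 3) θ) H) = S₁ (n + m) H := by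
    intro a hInv n m hn hm F G hF hG hFc hGc H hH θ
    -- the four doubled blocks and their trigonometric data (stub 3)
    obtain ⟨HFF, hHFF⟩ := exists_isAppendTensorOf (osAdjoint F) F
    obtain ⟨HGF, hHGF⟩ := exists_isAppendTensorOf (osAdjoint G) F
    obtain ⟨HGG, hHGG⟩ := exists_isAppendTensorOf (osAdjoint G) G
    obtain ⟨Kp, p, hp⟩ := hband n n F F hF hF hFc hFc HFF hHFF
    obtain ⟨Kq, q, hq⟩ := hband n m F G hF hG hFc hGc H hH
    obtain ⟨Kq', q', hq'⟩ := hband m n G F hG hF hGc hFc HGF hHGF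
    obtain ⟨Kr, r, hr⟩ := hband m m G G hG hG hGc hGc HGG hHGG
    -- boost inheritance (stub 4): the pencil is PSD on both half-lines
    have hpsd := hpos n m F G hF hG hFc hGc HFF H HGF HGG hHFF hH hHGF hHGG Kp Kq Kq' Kr p q q' r hp hq hq' hr
    -- level growth (stub 5) at the levels `n` and `m`: no diagonal layer `|k| ≥ 2`
    have hp2 : ∀ k ∈ Finset.Icc (-(Kp : ℤ)) Kp, 2 ≤ |k| → p k = 0 :=
      hgrow n (fun N hN => hInv N (by omega)) F hF hFc HFF hHFF Kp p hp
    have hr2 : ∀ k ∈ Finset.Icc (-(Kr : ℤ)) Kr, 2 ≤ |k| → r k = 0 :=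
      hgrow m (fun N hN => hInv N (by omega)) G hG hGc HGG hHGG Kr r hr
    -- parity + Cauchy–Schwarz (the proved sieve): the `(F,G)` block is constant
    have hq0 : ∀ k ∈ Finset.Icc (-(Kq : ℤ)) Kq, k ≠ 0 → q k = 0 :=
      stub_paritySieve Kp Kq Kq' Kr p q q' r hpsd hp2 hr2
    calc S₁ (n + m) (linActMulti (planeRot (0 : Fin 3) θ) H)
        = ∑ k ∈ Finset.Icc (-(Kq : ℤ)) Kq, q k * Complex.exp (4 * (k : ℂ) * (θ : ℂ) * Complex.I) := hq θ
      _ = ∑ k ∈ Finset.Icc (-(Kq : ℤ)) Kq,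
            q k * Complex.exp (4 * (k : ℂ) * ((0 : ℝ) : ℂ) * Complex.I) := by
          refine Finset.sum_congr rfl fun k hk => ?_
          by_cases hk0 : k = 0
          · subst hk0; simp
          · rw [hq0 k hk hk0]; simp
      _ = S₁ (n + m) (linActMulti (planeRot (0 : Fin 3) 0) H) := (hq 0).symm
      _ = S₁ (n + m) H := by rw [linActMulti_planeRot_angle_zero]
  -- the induction on the level
  have hQ : ∀ a n m : ℕ, n ≤ a → m ≤ a →
      ∀ (F : 𝓢((Fin n → E4), ℂ)) (G : 𝓢((Fin m → E4), ℂ)),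
        IsTimeOrdered F → IsTimeOrdered G →
        HasCompactSupport (F : (Fin n → E4) → ℂ) → HasCompactSupport (G : (Fin m → E4) → ℂ) →
        ∀ H : 𝓢((Fin (n + m) → E4), ℂ), IsAppendTensorOf H (osAdjoint F) G →
          ∀ θ : ℝ, S₁ (n + m) (linActMulti (planeRot (0 : Fin 3) θ) H) = S₁ (n + m) H := by
    intro a
    induction a with
    | zero => exact level_step 0 fun N hN => absurd hN (by omega)
    | succ a ih => exact level_step (a + 1) fun N hN => hd2i a ih N (by omega)
  -- every degree
  intro R hdet h2 h3 N F hF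
  exact hd2i N (hQ N) N (by omega) R hdet h2 h3 F hF

/-! ## THE CERTIFICATE -/

/-- **The planar cone of a `W₁`-family** is the landed theorem of item 9664 (E0' + E3 + translations + eight frames). [folklore] -/
theorem planarCone_of_W1 {G : Type} [Group G] [TopologicalSpace G] [IsTopologicalGroup G] [CompactSpace G]
    [MeasurableSpace G] [BorelSpace G] {r : LatticeRep G} {sch : SpeciesScheme (YMSpecies G)} {S₁ : SchwingerFamily E4}
    (hW : W1 r sch S₁) (h8 : EightFrameRP S₁) : PlanarCone S₁ :=
  Summit.QuantumFields.YangMills.Cruxes.PlanarSpectralCone.PositivityDiscToOperatorCone.PlanarSpectralCone_of S₁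
    hW.2.1.2.2.1 hW.2.1.2.2.2.2.1 hW.2.2.1 h8

/-- **THE CORE CERTIFICATE of crux `PencilRigidity.NPointIsotropy` (stmt-QuantumFields-11686).**  The crux follows from the
three registered statements it shares with stmt-QuantumFields-9663 — Step 0 (`hStep0`), the doubled orbit kernel (`hDOK`) and
the level growth at levels `a ≥ 2` (`hHigh`) — and nothing else: the cone is the theorem of 9664, the level growth at levels
`a ≤ 1` is free from the crux's radial kernel, the rest is the sibling's landed sieve.  Sorry-free; the three hypotheses are the
honest residual of the line `complex-rotation-bandlimit` (generation 7). [folklore] -/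
theorem nPointIsotropy_of_inputs
    (hStep0 :
      ∀ (G : Type) [Group G] [TopologicalSpace G] [IsTopologicalGroup G] [CompactSpace G]
        [MeasurableSpace G] [BorelSpace G], IsCompactSimpleLieGroup G →
        ∀ (r : LatticeRep G) (sch : SpeciesScheme (YMSpecies G)) (S₁ : SchwingerFamily E4),
          W1 r sch S₁ → EightFrameRP S₁ → PlanarCone S₁ → NPointRegular S₁)
    (hDOK :
      ∀ (S₁ : SchwingerFamily E4) (h : OSReconstructionNoE1 S₁.toLabelled),
        S₁.toLabelled.HasLinearGrowth → S₁.toLabelled.IsSymmetric → EightFrameRP S₁ → PlanarCone S₁ →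
        (∀ (ψ : h.Hilbert) (μ : MeasureTheory.Measure E4), h.IsJointSpectralMeasure ψ μ →
          μ {p : E4 | p 0 < |p 1|} = 0) →
        ∀ (n : ℕ), ∃ N : ℝ, ∀ (F : SchwartzMap (Fin n → E4) ℂ), IsTimeOrdered F →
          HasCompactSupport (F : (Fin n → E4) → ℂ) →
          ∃ ε : ℝ, 0 < ε ∧
            (∀ η : ℝ, |η| < ε → IsTimeOrdered (linActMulti (planeRot (0 : Fin 3) η) F)) ∧
            ∃ (K : ℂ → ℂ → ℂ) (C : ℝ),
              DifferentiableOn ℂ (Function.uncurry K) ({z : ℂ | |z.re| < ε} ×ˢ {z : ℂ | |z.re| < ε}) ∧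
              (∀ θ : ℂ, |θ.re| < ε → ‖K (starRingEnd ℂ θ) θ‖ ≤ C * Real.exp (2 * N * |θ.im|)) ∧
              ∀ η η' : ℝ, |η| < ε → |η'| < ε →
                ∀ H : SchwartzMap (Fin (n + n) → E4) ℂ,
                  IsAppendTensorOf H (osAdjoint (linActMulti (planeRot (0 : Fin 3) η') F))
                    (linActMulti (planeRot (0 : Fin 3) η) F) →
                  K η' η = S₁ (n + n) H )
    (hHigh :
      ∀ (G : Type) [Group G] [TopologicalSpace G] [IsTopologicalGroup G] [CompactSpace G]
        [MeasurableSpace G] [BorelSpace G], IsCompactSimpleLieGroup G →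
        ∀ (r : LatticeRep G) (sch : SpeciesScheme (YMSpecies G)) (S₁ : SchwingerFamily E4),
          W1 r sch S₁ → EightFrameRP S₁ → PlanarCone S₁ →
          ∀ a : ℕ, 2 ≤ a →
            (∀ N : ℕ, N + 2 ≤ 2 * a → ∀ R : E4 ≃ₗᵢ[ℝ] E4,
              LinearMap.det (R.toLinearEquiv : E4 →ₗ[ℝ] E4) = 1 →
              R (EuclideanSpace.single 2 1) = EuclideanSpace.single 2 1 →
              R (EuclideanSpace.single 3 1) = EuclideanSpace.single 3 1 →
              ∀ F : SchwartzMap (Fin N → E4) ℂ, IsOffDiagonal F → S₁ N (linActMulti R F) = S₁ N F) →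
            ∀ (F : SchwartzMap (Fin a → E4) ℂ), IsTimeOrdered F → HasCompactSupport (F : (Fin a → E4) → ℂ) →
            ∀ H : SchwartzMap (Fin (a + a) → E4) ℂ, IsAppendTensorOf H (osAdjoint F) F →
            ∀ (K : ℕ) (p : ℤ → ℂ),
              (∀ θ : ℝ, S₁ (a + a) (linActMulti (planeRot (0 : Fin 3) θ) H) =
                ∑ k ∈ Finset.Icc (-(K : ℤ)) K, p k * Complex.exp (4 * (k : ℂ) * (θ : ℂ) * Complex.I)) →
              ∀ k ∈ Finset.Icc (-(K : ℤ)) K, 2 ≤ |k| → p k = 0 ) :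
    Summit.QuantumFields.YangMills.Theses.PencilRigidity.NPointIsotropy := by
  rw [nPointIsotropy_iff]
  intro G _ _ _ _ hG
  letI : MeasurableSpace G := borel G
  haveI : BorelSpace G := ⟨rfl⟩
  intro r sch S₁ hW h8 hK
  have hC : PlanarCone S₁ := planarCone_of_W1 hW h8
  have hreg : NPointRegular S₁ := hStep0 G hG r sch S₁ hW h8 hC  -- Step 0 (the tie)
  have hhigh := hHigh G hG r sch S₁ hW h8 hC  -- the bet; levels a ≤ 1 are free from the radial kernel
  obtain ⟨-, hOS, htr, hhyp, -⟩ := hW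
  refine planarInvariant_of_inputs (uniformPlanarBoostVectors_of_kernel hDOK) S₁ hOS htr hhyp h8 hC hreg fun a => ?_
  by_cases ha : a ≤ 1
  · exact levelGrowthLow_shape hK a ha
  · exact hhigh a (by omega)

end Summit.QuantumFields.YangMills.Theorems.NPointIsotropy.ComplexRotationBandlimit

end
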